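import Summits.BirchSwinnertonDyer.BirchSwinnertonDyer.Theorems.BiquadraticEisensteinDescentManinDatumSupercuspidalCMInertModelLValuesOfTorsionIntegral
import Summits.BirchSwinnertonDyer.BirchSwinnertonDyer.Theorems.BiquadraticEisensteinDescentManinDatumSupercuspidalCMInertFiniteFormulaCRT
import HarnessLib

/-!
# Crux `ManinDatumSupercuspidalCMInert`, stub `stub_S7`: `H₇` from the BÉZOUT-FREE `7`-torsion core
# (the torsion hypothesis T₇ does not depend on its Bézout coefficient `α`)

Summit `BirchSwinnertonDyer`, crux `ManinDatumSupercuspidalCMInert` (stmt-BirchSwinnertonDyer-20111, BED r605), registered stub `stub_S7`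
(`j = 1728` at `p = 7`, Kodaira `III`/`III*`; skeleton 9438078f). Width seat bsd-wall-cm-bed-w3 g9 (`--supports 20111`, helper; DICTIONARY
LANE). The Kato-fact-free reshaping PLAIN-ODD-57 (memo `Cruxes/ManinDatumSupercuspidalCMInert/PLAIN-ODD-57-w4g10.md`) is kernel-checked end
to end as `stub_S7 ⟸ H₇ ⟸ T₇` (bed-w4 g10 p634645/p634975; bed-w2 g10 `…StubsOfModelLValues.stub_S7_of_modelOddLValues`,
`…ThetaValueAssembly`, `…ModelLValuesOfTorsionIntegral.H7_of_torsionIntegral`; this seat's dictionary `QuarticTwist.lSeries_twist_eq_thetaLFunction_inert`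
p635899 on `quarticCharMod 7 = (·/7)₄` p635076), where the research core T₇ reads: for `k ∈ {1,2,3}`, `M′` prime to `7`, EVERY INTEGER `α`
PRIME TO `7`, and `w` with `M′w ∈ ℤi + ℤ`, `s·(Σ_{a mod 7} \overline{(a/7)₄}^k E₁*(w + α·ā/7))/(ϖ₀·7^{(4−k)/4}) ∈ ℤ̄` for some `7 ∤ s`. The
quantifier over the Bézout coefficient `α` is spurious: `(α/7)₄ = 1` for a rational `α` prime to `7` (Ireland–Rosen Prop. 9.8.4), so re-indexing
`a ↦ −α·a` turns every such sum into the single sum `T_k(w) := Σ_{b mod 7} \overline{(b/7)₄}^k E₁*(w − b̄/7)` (this seat's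
`…FiniteFormulaCRT.sum_qClasses_absorb`, p636583). This file records that reduction (for every inert prime `q ≡ 3 (4)`) and the resulting closers:

* `phiq_periodic`, `phiq_intCast_mul` — the weight `Φ = \overline{(·/q)₄}^k` is `q`-periodic and blind to rational integers prime to `q`;
* ★ `torsionSum_eq_of_not_dvd` — `Σ_{a mod q} Φ(a)E₁*(w + α·ā/q) = T_k(w)` for every `α` prime to `q`;
* ★ `torsionIntegral_of_core` — the Bézout-free core `Core_q` («for `k ∈ {1,2,3}`, `M′` prime to `q`, `w` with `M′w ∈ Λ`:
  `s·T_k(w)/(ϖ₀·q^{(4−k)/4}) ∈ ℤ̄`, `q ∤ s`») implies the torsion hypothesis in bed-w2 g10's `α`-indexed shape (any inert `q`);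
* ★ `H7_of_core` — `Core₇ ⟹ H₇` (:= `H7_of_torsionIntegral ∘ torsionIntegral_of_core`); the registered signature of `stub_S7` from `Core₇`
  alone is then the one-liner `stub_S7_of_modelOddLValues (H7_of_core hcore)` (left to the route-cone companion of `…StubsOfModelLValues`,
  so that this file stays outside the route file's import cone).

`Core₇` is PLAIN-ODD-57 §3's «new brick» with one quantifier fewer: the `7`-adic order `≥ 1 − k/4` of the `48`-term sums `T_k(w)` at the
prime-to-`7` torsion points `w` of `ℤi + ℤ` (a tame Lagrange-resolvent count in `ℚ₇(i)(E₀[7])`; bed-w4 g10's `…TameResolvent` /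
`…SevenDivisionEisenstein` / `…FormalChord` type its local algebra). HONEST FRAMING: conditional on `Core₇`, which is NOT proved; dominance
`F″ ⟹ H₇` (p634978) untouched; nothing here proves `stub_S7`, the crux, Manin's conjecture or BSD. No definition, no named fact, no `sorry`;
axioms standard.
-/

set_option autoImplicit false
-- the summit namespace `Summit.BirchSwinnertonDyer.BirchSwinnertonDyer.…` (summit = problem) trips `dupNamespace` on every declaration
set_option linter.dupNamespace false

noncomputable section

open scoped ComplexConjugate
open Complex PeriodPair
open Literature.NumberTheory.EllipticCurves Literature.NumberTheory.EllipticCurves.GaussianLattice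
open Literature.NumberTheory.EllipticCurves.ModularForms Literature.NumberTheory.EllipticCurves.Rank1Residual
open Literature.NumberTheory.LFunctions Literature.NumberTheory.LFunctions.GaussianTheta
open Literature.NumberTheory.QuadraticFields.GaussianQuarticSymbol

namespace Summit.BirchSwinnertonDyer.BirchSwinnertonDyer.Theorems.BiquadraticEisensteinDescentManinDatumSupercuspidalCMInertTorsionCoreBezoutFree

open Summit.BirchSwinnertonDyer.BirchSwinnertonDyer.Theorems.BiquadraticEisensteinDescentManinDatumSupercuspidalCMInertFiniteFormulaCRT
  (sum_qClasses_absorb)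
open Summit.BirchSwinnertonDyer.BirchSwinnertonDyer.Theorems.BiquadraticEisensteinDescentManinDatumSupercuspidalCMInertModelLValuesOfTorsionIntegral
  (H7_of_torsionIntegral)

/-! ## §1 The weight `Φ = \overline{(·/q)₄}^k` and the Bézout-free torsion sums -/

section Weight

variable {q : ℕ} (hq : q.Prime) (hq3 : q % 4 = 3)
include hq hq3

omit hq3 in
/-- An integer prime to the prime `q` is not divisible by `q`. [folklore] -/
theorem not_dvd_of_isCoprime {f : ℤ} (hf : IsCoprime f (q : ℤ)) : ¬ (q : ℤ) ∣ f := by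
  intro h
  have h1 : IsCoprime (q : ℤ) (q : ℤ) := (hf.of_isCoprime_of_dvd_left h)
  have := Int.isCoprime_iff_gcd_eq_one.mp h1
  rw [Int.gcd_self, Int.natAbs_natCast] at this
  exact hq.one_lt.ne' this

omit hq3 in
/-- An integer not divisible by the prime `q` is coprime to `q`. [folklore] -/
theorem isCoprime_of_not_dvd {f : ℤ} (hf : ¬ (q : ℤ) ∣ f) : IsCoprime f (q : ℤ) :=
  ((Irreducible.coprime_iff_not_dvd (Nat.prime_iff_prime_int.mp hq).irreducible).mpr hf).symm

omit hq hq3 in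
/-- `Φ = \overline{(·/q)₄}^k` is periodic modulo `q`. [cite: IrelandRosen1982, Ch. 9 §8, Definition after Prop. 9.8.4 (remark)] -/
theorem phiq_periodic (k : ℕ) (x y : GaussianInt) :
    (conj (((quarticCharMod q (x + q * y) : GaussianInt) : ℂ))) ^ k = (conj (((quarticCharMod q x : GaussianInt) : ℂ))) ^ k := by
  rw [show x + (q : GaussianInt) * y = x + ((q : ℤ) : GaussianInt) * y by push_cast; ring, quarticCharMod_add_mul]

/-- `Φ = \overline{(·/q)₄}^k` is blind to rational integers prime to `q`: `Φ(f·x) = Φ(x)` (`(f/q)₄ = 1`).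
[cite: IrelandRosen1982, Ch. 9 §8, Prop. 9.8.4] -/
theorem phiq_intCast_mul (k : ℕ) {f : ℤ} (hf : IsCoprime f (q : ℤ)) (x : GaussianInt) :
    (conj (((quarticCharMod q ((f : GaussianInt) * x) : GaussianInt) : ℂ))) ^ k =
      (conj (((quarticCharMod q x : GaussianInt) : ℂ))) ^ k := by
  rw [quarticCharMod_mul, quarticCharMod_natCast_intCast hq hq3 (not_dvd_of_isCoprime hq hf), one_mul]

/-- ★ **The torsion sums do not depend on the Bézout coefficient**: for `α` prime to `q` and any `w`,
`Σ_{a mod q} \overline{(a/q)₄}^k E₁*(w + α·ā/q) = T_k(w) := Σ_{b mod q} \overline{(b/q)₄}^k E₁*(w − b̄/q)` (re-index by `a ↦ −α·a`,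
`(−α/q)₄ = 1`). [folklore] -/
theorem torsionSum_eq_of_not_dvd [NeZero q] (k : ℕ) {α : ℤ} (hα : ¬ (q : ℤ) ∣ α) (w : ℂ) :
    ∑ a : ZMod q × ZMod q, (conj (((quarticCharMod q (rep q a 0) : GaussianInt) : ℂ))) ^ k *
        kroneckerE₁ (w + (α : ℂ) * conj ((rep q a 0 : GaussianInt) : ℂ) / q) =
      ∑ b : ZMod q × ZMod q, (conj (((quarticCharMod q (rep q b 0) : GaussianInt) : ℂ))) ^ k *
        kroneckerE₁ (w - conj ((rep q b 0 : GaussianInt) : ℂ) / q) := by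
  have hα' : IsCoprime (-α) (q : ℤ) := (isCoprime_of_not_dvd hq hα).neg_left
  rw [← sum_qClasses_absorb q (Φ := fun x ↦ (conj (((quarticCharMod q x : GaussianInt) : ℂ))) ^ k)
    (phiq_periodic k) hα' (phiq_intCast_mul hq hq3 k hα') w]
  refine Finset.sum_congr rfl fun a _ ↦ ?_
  rw [show w + (α : ℂ) * conj ((rep q a 0 : GaussianInt) : ℂ) / q =
      w - (((-α : ℤ) : ℂ)) * conj ((rep q a 0 : GaussianInt) : ℂ) / q by push_cast; ring]

end Weight

/-! ## §2 The Bézout-free core implies the `α`-indexed torsion hypothesis (any inert prime `q`) -/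

section Core

/-- ★ **`Core_q ⟹ T_q`.** If for every `k ∈ {1,2,3}`, every `M′` prime to `q` and every `w` with `M′w ∈ ℤi + ℤ` the Bézout-free sum
`T_k(w) = Σ_{b mod q} \overline{(b/q)₄}^k E₁*(w − b̄/q)` satisfies `s·T_k(w)/(ϖ₀·q^{(4−k)/4}) ∈ ℤ̄` for some `q ∤ s`, then the same holds for
`Σ_{a mod q} \overline{(a/q)₄}^k E₁*(w + α·ā/q)` for EVERY integer `α` prime to `q` — the torsion hypothesis of bed-w2 g10's
`…ThetaValueAssembly.oddLValue_quartic_of_dictionary_of_torsionIntegral` / `…ModelLValuesOfTorsionIntegral.H7_of_torsionIntegral` (there `q = 7`).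
[folklore] -/
theorem torsionIntegral_of_core {q : ℕ} [NeZero q] (hq : q.Prime) (hq3 : q % 4 = 3)
    (hcore : ∀ k : ℕ, 1 ≤ k → k ≤ 3 → ∀ (M' : ℕ) [NeZero M'], Nat.Coprime q M' →
      ∀ w : ℂ, ((M' : ℂ) * w) ∈ (ofUpperHalfPlane UpperHalfPlane.I).lattice →
        ∃ s : ℕ, ¬ q ∣ s ∧ IsIntegral ℤ ((s : ℂ) *
          (∑ b : ZMod q × ZMod q, (conj (((quarticCharMod q (rep q b 0) : GaussianInt) : ℂ))) ^ k *
            kroneckerE₁ (w - conj ((rep q b 0 : GaussianInt) : ℂ) / q)) /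
          ((((Real.Gamma (1 / 4) ^ 2 / (2 * Real.sqrt (2 * Real.pi))) : ℝ) : ℂ) * (q : ℂ) ^ (((4 - k : ℕ) : ℂ) / 4)))) :
    ∀ k : ℕ, 1 ≤ k → k ≤ 3 → ∀ (M' : ℕ) [NeZero M'], Nat.Coprime q M' →
      ∀ (α : ℤ), ¬ (q : ℤ) ∣ α → ∀ w : ℂ, ((M' : ℂ) * w) ∈ (ofUpperHalfPlane UpperHalfPlane.I).lattice →
        ∃ s : ℕ, ¬ q ∣ s ∧ IsIntegral ℤ ((s : ℂ) *
          (∑ a : ZMod q × ZMod q, (conj (((quarticCharMod q (rep q a 0) : GaussianInt) : ℂ))) ^ k *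
            kroneckerE₁ (w + (α : ℂ) * conj ((rep q a 0 : GaussianInt) : ℂ) / q)) /
          ((((Real.Gamma (1 / 4) ^ 2 / (2 * Real.sqrt (2 * Real.pi))) : ℝ) : ℂ) * (q : ℂ) ^ (((4 - k : ℕ) : ℂ) / 4))) := by
  intro k hk1 hk3 M' _ hM' α hα w hw
  rw [torsionSum_eq_of_not_dvd hq hq3 k hα w]
  exact hcore k hk1 hk3 M' hM' w hw

end Core

/-! ## §3 `q = 7`: `H₇` from `Core₇` -/

section Seven

/-- **`Core₇ ⟹ H₇`**: the Bézout-free `7`-torsion core gives the hypothesis `H₇` of bed-w2 g10's `stub_S7_of_modelOddLValues` (verbatim),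
through `H7_of_torsionIntegral`. [cite: Rubin1999, Prop. 7.15] -/
theorem H7_of_core
    (hcore : ∀ k : ℕ, 1 ≤ k → k ≤ 3 → ∀ (M' : ℕ) [NeZero M'], Nat.Coprime 7 M' →
      ∀ w : ℂ, ((M' : ℂ) * w) ∈ (ofUpperHalfPlane UpperHalfPlane.I).lattice →
        ∃ s : ℕ, ¬ 7 ∣ s ∧ IsIntegral ℤ ((s : ℂ) *
          (∑ b : ZMod 7 × ZMod 7, (conj (((quarticCharMod 7 (rep 7 b 0) : GaussianInt) : ℂ))) ^ k *
            kroneckerE₁ (w - conj ((rep 7 b 0 : GaussianInt) : ℂ) / 7)) /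
          ((((Real.Gamma (1 / 4) ^ 2 / (2 * Real.sqrt (2 * Real.pi))) : ℝ) : ℂ) * (7 : ℂ) ^ (((4 - k : ℕ) : ℂ) / 4)))) :
    ∀ (A : ℤ), A ≠ 0 → (7 : ℤ) ∣ A → (∀ q : ℕ, q.Prime → ¬ ((q : ℤ) ^ 4 ∣ A)) →
      ∀ (ℓ : ℕ) [NeZero ℓ], ℓ.Prime → ℓ ≠ 2 → ¬ (ℓ : ℤ) ∣ A → ¬ 4 ∣ ℓ - 1 → ¬ 7 ∣ ℓ - 1 → ¬ 3 ∣ ℓ - 1 →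
        IsSquare ((7 : ℕ) : ZMod ℓ) →
      ∀ χ : DirichletCharacter ℂ ℓ, χ.Odd →
      ∃ L : ℂ → ℂ, Differentiable ℂ L ∧
        (∀ s : ℂ, 2 < s.re → L s = LSeries (fun n : ℕ ↦ χ⁻¹ (n : ZMod ℓ) *
          ((⟨0, 0, 0, (A : ℚ), 0⟩ : WeierstrassCurve ℚ).LFunction n : ℂ)) s) ∧
        ∃ s : ℕ, ¬ 7 ∣ s ∧ IsIntegral ℤ ((s : ℂ) * (gaussSum χ (ZMod.stdAddChar (N := ℓ)) * L 1 /
          (Complex.I * ((⟨0, 0, 0, (A : ℚ), 0⟩ : WeierstrassCurve ℚ).imaginaryPeriodRat : ℂ)))) :=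
  H7_of_torsionIntegral (fun k hk1 hk3 M' _ hM' α hα w hw ↦ by
    exact_mod_cast torsionIntegral_of_core (q := 7) (by norm_num) (by norm_num)
      (fun k hk1 hk3 M' _ hM' w hw ↦ by exact_mod_cast hcore k hk1 hk3 M' hM' w hw) k hk1 hk3 M' hM' α hα w hw)

end Seven

end Summit.BirchSwinnertonDyer.BirchSwinnertonDyer.Theorems.BiquadraticEisensteinDescentManinDatumSupercuspidalCMInertTorsionCoreBezoutFree

end
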